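import Summits.HubbardSuperconductivity.HubbardSuperconductivity.Theorems.PerturbedXYOrder.Negative.ChargedFieldPinching

/-!
# `PerturbedXYOrder` (stmt-HubbardSuperconductivity-10739) — line `schwarz-inheritance`, tools for stub `stub_twistedJensenBound` (II)

The axial twists `g_k(x) = 2πk x₀/L` (`x₀ ∈ ℤ/Lℤ` through its representative in `{0,…,L−1}`) used as Mermin–Wagner trial states in the
Goldstone pinching of the invariant mean-field source (lead c19; `Theorems/PerturbedXYOrder/Negative/InvariantMeanFieldPinching.lean`):

* `gp_cos_twist_bond`, `gp_twist_cost`, `gp_twist_cost_le` — bond increments and **cost** of the twist: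
  `Σ_b (1 − cos ∇_b g_k) = L³ (1 − cos(2πk/L)) ≤ 2π² k² L` (only direction-`0` bonds pay; the wrap-around bond pays the same);
* `gp_twistCorr_nonneg` — the twisted two-point sum `Σ_{x,y} cos(θ_x − θ_y) cos(g_x − g_y) = ½(|M_{+g}|² + |M_{−g}|²) ≥ 0`;
* `gp_charSum` — **orthogonality of the characters of `ℤ/Lℤ`**: `Σ_{k<L} cos(2πk a/L − 2πk b/L) = L·[a = b]` (geometric sum of roots of unity);
* `gp_charSum_bound`, `gp_twistCorr_sum_le` — the **character-sum bound**
  `Σ_{k=1}^{m} Σ_{x,y} cos(θ_x − θ_y) cos(g_k x − g_k y) ≤ Σ_{k<L} (…) = L Σ_{x₀ = y₀} cos(θ_x − θ_y) ≤ L⁶` for `m < L`: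
  on average over the wave numbers `k`, the twisted magnetisation `|M_k|²` is at most `L⁶/L`, although `|M_0|² ≈ m₀² L⁶`.
-/

noncomputable section

namespace Summit.HubbardSuperconductivity.HubbardSuperconductivity.Theorems.PerturbedXYOrder

open MeasureTheory Literature.Probability.LatticeModels Metric Set
open Summit.HubbardSuperconductivity.HubbardSuperconductivity.Theses.NodalWardXY

variable {L : ℕ}

/-- Bond increments of the axial twist `g_k(x) = 2πk x₀/L`: `cos ∇_b g_k = cos(2πk/L)` on bonds in direction `0` and `= 1` on the
others (the wrap-around bond has increment `2πk/L − 2πk`). -/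
theorem gp_cos_twist_bond [NeZero L] (hL : 2 ≤ L) (k : ℕ) (x : TorusSite 3 L) (i : Fin 3) :
    Real.cos (2 * Real.pi * k * (((x + Pi.single i 1 : TorusSite 3 L) 0).val : ℝ) / L - 2 * Real.pi * k * ((x 0).val : ℝ) / L) =
      if i = 0 then Real.cos (2 * Real.pi * k / L) else 1 := by
  have hL0 : (L : ℝ) ≠ 0 := by have := NeZero.ne L; exact_mod_cast this
  by_cases hi : i = 0
  · subst hi
    rw [if_pos rfl]
    haveI : Fact (1 < L) := ⟨hL⟩
    have hadd : (x + Pi.single (0 : Fin 3) (1 : ZMod L) : TorusSite 3 L) 0 = x 0 + 1 := by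
      simp
    rw [hadd, ZMod.val_add, ZMod.val_one]
    have hlt : (x 0).val < L := ZMod.val_lt _
    rcases Nat.lt_or_ge ((x 0).val + 1) L with h | h
    · rw [Nat.mod_eq_of_lt h]
      push_cast
      congr 1
      field_simp
      ring
    · have heq : (x 0).val + 1 = L := le_antisymm hlt h
      rw [heq, Nat.mod_self]
      push_cast
      have : 2 * Real.pi * k * (0 : ℝ) / L - 2 * Real.pi * k * ((x 0).val : ℝ) / L =
          2 * Real.pi * k / L - (k : ℕ) * (2 * Real.pi) := by
        have hv : ((x 0).val : ℝ) = L - 1 := by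
          have : (((x 0).val + 1 : ℕ) : ℝ) = L := by exact_mod_cast heq
          push_cast at this; linarith
        rw [hv]
        field_simp
        ring
      rw [this, Real.cos_sub_nat_mul_two_pi]
  · rw [if_neg hi]
    have hadd : (x + Pi.single i (1 : ZMod L) : TorusSite 3 L) 0 = x 0 := by
      rw [Pi.add_apply, Pi.single_eq_of_ne (fun h => hi h.symm), add_zero]
    rw [hadd, sub_self, Real.cos_zero]

/-- **Cost of the axial twist**: `Σ_b (1 − cos ∇_b g_k) = L³ (1 − cos(2πk/L))`. -/
theorem gp_twist_cost [NeZero L] (hL : 2 ≤ L) (k : ℕ) :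
    ∑ b : Bond L, (1 - Real.cos (2 * Real.pi * k * (((b.1 + Pi.single b.2 1 : TorusSite 3 L) 0).val : ℝ) / L -
        2 * Real.pi * k * ((b.1 0).val : ℝ) / L)) =
      (L : ℝ) ^ 3 * (1 - Real.cos (2 * Real.pi * k / L)) := by
  rw [Fintype.sum_prod_type]
  simp only [gp_cos_twist_bond hL k, Finset.sum_const, Finset.card_univ, nsmul_eq_mul, cfp_card]
  congr 1
  rw [Fin.sum_univ_three]
  simp

/-- The cost of the axial twist `g_k`, `k ≤ m`, is at most `2π² m² L`. -/
theorem gp_twist_cost_le [NeZero L] (hL : 2 ≤ L) {k m : ℕ} (hk : k ≤ m) :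
    ∑ b : Bond L, (1 - Real.cos (2 * Real.pi * k * (((b.1 + Pi.single b.2 1 : TorusSite 3 L) 0).val : ℝ) / L -
        2 * Real.pi * k * ((b.1 0).val : ℝ) / L)) ≤
      2 * Real.pi ^ 2 * (m : ℝ) ^ 2 * L := by
  rw [gp_twist_cost hL k]
  have hL0 : (0 : ℝ) < L := by have := NeZero.pos L; exact_mod_cast this
  have h1 : 1 - Real.cos (2 * Real.pi * k / L) ≤ (2 * Real.pi * k / L) ^ 2 / 2 := by
    linarith [Real.one_sub_sq_div_two_le_cos (x := 2 * Real.pi * k / L)]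
  have hk' : (k : ℝ) ≤ m := by exact_mod_cast hk
  calc (L : ℝ) ^ 3 * (1 - Real.cos (2 * Real.pi * k / L))
      ≤ (L : ℝ) ^ 3 * ((2 * Real.pi * k / L) ^ 2 / 2) := mul_le_mul_of_nonneg_left h1 (by positivity)
    _ = 2 * Real.pi ^ 2 * (k : ℝ) ^ 2 * L := by field_simp
    _ ≤ 2 * Real.pi ^ 2 * (m : ℝ) ^ 2 * L := by gcongr

/-- The twisted two-point sum `Σ_{x,y} cos(θ_x − θ_y) cos(g_x − g_y)` is non-negative for every phase field `g`
(`= ½ (|Σ_x e^{i(θ_x + g_x)}|² + |Σ_x e^{i(θ_x − g_x)}|²)`). -/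
theorem gp_twistCorr_nonneg [NeZero L] (θ g : TorusSite 3 L → ℝ) :
    0 ≤ ∑ x : TorusSite 3 L, ∑ y : TorusSite 3 L, Real.cos (θ x - θ y) * Real.cos (g x - g y) := by
  have h1 := cfp_sum_cos_sub (L := L) (fun v => θ v + g v)
  have h2 := cfp_sum_cos_sub (L := L) (fun v => θ v - g v)
  have hsum : ∑ x : TorusSite 3 L, ∑ y : TorusSite 3 L, Real.cos (θ x - θ y) * Real.cos (g x - g y) =
      ((∑ x : TorusSite 3 L, ∑ y : TorusSite 3 L, Real.cos ((θ x + g x) - (θ y + g y))) +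
        ∑ x : TorusSite 3 L, ∑ y : TorusSite 3 L, Real.cos ((θ x - g x) - (θ y - g y))) / 2 := by
    rw [← Finset.sum_add_distrib, Finset.sum_div]
    refine Finset.sum_congr rfl fun x _ => ?_
    rw [← Finset.sum_add_distrib, Finset.sum_div]
    refine Finset.sum_congr rfl fun y _ => ?_
    have e1 : (θ x + g x) - (θ y + g y) = (θ x - θ y) + (g x - g y) := by ring
    have e2 : (θ x - g x) - (θ y - g y) = (θ x - θ y) - (g x - g y) := by ring
    rw [e1, e2, Real.cos_add (θ x - θ y) (g x - g y), Real.cos_sub (θ x - θ y) (g x - g y)]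
    ring
  rw [hsum, h1, h2]
  positivity

/-- **Orthogonality of the characters of `ℤ/Lℤ`**: `Σ_{k<L} cos(2πk a/L − 2πk b/L) = L` if `a = b` and `= 0` otherwise
(`a, b ∈ ℤ/Lℤ` through their representatives in `{0,…,L−1}`; geometric sum of the `L`-th roots of unity). [folklore] -/
theorem gp_charSum [NeZero L] (a b : ZMod L) :
    ∑ k ∈ Finset.range L, Real.cos (2 * Real.pi * k * (a.val : ℝ) / L - 2 * Real.pi * k * (b.val : ℝ) / L) =
      if a = b then (L : ℝ) else 0 := by
  have hL0 : (L : ℝ) ≠ 0 := by have := NeZero.ne L; exact_mod_cast this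
  by_cases hab : a = b
  · subst hab
    simp
  rw [if_neg hab]
  set δ : ℝ := (a.val : ℝ) - (b.val : ℝ) with hδ
  set u : ℝ := 2 * Real.pi * δ / L with hu
  set q : ℂ := Complex.exp (u * Complex.I) with hq
  have hterm : ∀ k : ℕ, Real.cos (2 * Real.pi * k * (a.val : ℝ) / L - 2 * Real.pi * k * (b.val : ℝ) / L) = (q ^ k).re := by
    intro k
    rw [hq, ← Complex.exp_nat_mul, ← mul_assoc]
    have : ((k : ℂ) * (u : ℂ)) = (((k : ℝ) * u : ℝ) : ℂ) := by push_cast; ring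
    rw [this, Complex.exp_ofReal_mul_I_re]
    congr 1
    rw [hu, hδ]
    field_simp
  simp_rw [hterm]
  rw [← Complex.re_sum]
  -- `q ≠ 1`
  have hδ0 : δ ≠ 0 := by
    intro h
    apply hab
    have : (a.val : ℝ) = b.val := by linarith
    exact ZMod.val_injective L (by exact_mod_cast this)
  have hδlt : |δ| < L := by
    have ha : (a.val : ℝ) < L := by exact_mod_cast ZMod.val_lt a
    have hb : (b.val : ℝ) < L := by exact_mod_cast ZMod.val_lt b
    have ha0 : (0 : ℝ) ≤ a.val := by positivity
    have hb0 : (0 : ℝ) ≤ b.val := by positivity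
    rw [abs_lt]; constructor <;> linarith
  have hq1 : q ≠ 1 := by
    intro h
    rw [hq, Complex.exp_eq_one_iff] at h
    obtain ⟨n, hn⟩ := h
    have hre : u = n * (2 * Real.pi) := by
      have := congrArg Complex.im hn
      simp at this
      linarith
    have hδn : δ = n * L := by
      rw [hu] at hre
      field_simp at hre
      nlinarith [Real.pi_pos]
    have hn0 : n ≠ 0 := by
      rintro rfl
      simp at hδn
      exact hδ0 hδn
    have h1 : (1 : ℝ) ≤ |(n : ℝ)| := by
      rw [← Int.cast_abs]
      exact_mod_cast Int.one_le_abs hn0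
    have hL1 : (0 : ℝ) < L := by have := NeZero.pos L; exact_mod_cast this
    have : (L : ℝ) ≤ |δ| := by
      rw [hδn, abs_mul, abs_of_pos hL1]
      nlinarith
    linarith
  -- `q ^ L = 1`
  have hqL : q ^ L = 1 := by
    have hLC : (L : ℂ) ≠ 0 := by exact_mod_cast NeZero.ne L
    rw [hq, ← Complex.exp_nat_mul, Complex.exp_eq_one_iff]
    refine ⟨(a.val : ℤ) - (b.val : ℤ), ?_⟩
    rw [hu, hδ]
    push_cast
    field_simp
  rw [geom_sum_eq hq1, hqL, sub_self, zero_div, Complex.zero_re]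

/-- Summing a function of the first coordinate over the torus: each fibre of `x ↦ x₀` has `L²` points. -/
theorem gp_sum_eval_zero [NeZero L] (f : ZMod L → ℝ) :
    ∑ x : TorusSite 3 L, f (x 0) = (L : ℝ) ^ 2 * ∑ a : ZMod L, f a := by
  have h1 : ∑ x : TorusSite 3 L, f (x 0) = ∑ p : ZMod L × (Fin 2 → ZMod L), f p.1 := by
    refine (Fintype.sum_equiv (Fin.consEquiv fun _ : Fin 3 => ZMod L) (fun p => f p.1) (fun x => f (x 0)) ?_).symm
    intro p
    simp [Fin.consEquiv]
  rw [h1, Fintype.sum_prod_type]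
  simp only [Finset.sum_const, Finset.card_univ, nsmul_eq_mul, Fintype.card_fun, Fintype.card_fin, ZMod.card]
  rw [Finset.mul_sum]
  push_cast
  ring_nf

/-- **Character-sum bound**: summed over all axial twists `g_k`, `k < L`, the twisted two-point sums are at most `L⁶`:
`Σ_{k<L} Σ_{x,y} cos(θ_x − θ_y) cos(g_k x − g_k y) = L Σ_{x₀ = y₀} cos(θ_x − θ_y) ≤ L · L³ · L² = L⁶`. -/
theorem gp_charSum_bound [NeZero L] (θ : TorusSite 3 L → ℝ) :
    ∑ k ∈ Finset.range L, ∑ x : TorusSite 3 L, ∑ y : TorusSite 3 L, Real.cos (θ x - θ y) *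
        Real.cos (2 * Real.pi * k * ((x 0).val : ℝ) / L - 2 * Real.pi * k * ((y 0).val : ℝ) / L) ≤
      ((L : ℝ) ^ 3) ^ 2 := by
  have hL0 : (0 : ℝ) ≤ L := by positivity
  rw [Finset.sum_comm]
  have hx : ∀ x : TorusSite 3 L,
      ∑ k ∈ Finset.range L, ∑ y : TorusSite 3 L, Real.cos (θ x - θ y) *
          Real.cos (2 * Real.pi * k * ((x 0).val : ℝ) / L - 2 * Real.pi * k * ((y 0).val : ℝ) / L) ≤
        (L : ℝ) ^ 3 := by
    intro x
    rw [Finset.sum_comm]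
    have hy : ∀ y : TorusSite 3 L,
        ∑ k ∈ Finset.range L, Real.cos (θ x - θ y) *
            Real.cos (2 * Real.pi * k * ((x 0).val : ℝ) / L - 2 * Real.pi * k * ((y 0).val : ℝ) / L) ≤
          if x 0 = y 0 then (L : ℝ) else 0 := by
      intro y
      rw [← Finset.mul_sum, gp_charSum (x 0) (y 0)]
      split_ifs with h
      · exact mul_le_of_le_one_left hL0 (Real.cos_le_one _)
      · rw [mul_zero]
    calc _ ≤ ∑ y : TorusSite 3 L, (if x 0 = y 0 then (L : ℝ) else 0) := Finset.sum_le_sum fun y _ => hy y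
      _ = (L : ℝ) ^ 2 * ∑ a : ZMod L, (if x 0 = a then (L : ℝ) else 0) :=
          gp_sum_eval_zero (fun a => if x 0 = a then (L : ℝ) else 0)
      _ = (L : ℝ) ^ 3 := by
          rw [Finset.sum_ite_eq Finset.univ (x 0) (fun _ => (L : ℝ)), if_pos (Finset.mem_univ _)]
          ring
  calc _ ≤ ∑ _x : TorusSite 3 L, (L : ℝ) ^ 3 := Finset.sum_le_sum fun x _ => hx x
    _ = ((L : ℝ) ^ 3) ^ 2 := by
        rw [Finset.sum_const, Finset.card_univ, nsmul_eq_mul, cfp_card]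
        ring

/-- Summed over the first `m < L` axial twists, the twisted two-point sums are at most `L⁶` (each `k`-term is non-negative,
`gp_twistCorr_nonneg`, and `{1,…,m} ⊆ {0,…,L−1}`). -/
theorem gp_twistCorr_sum_le [NeZero L] {m : ℕ} (hmL : m < L) (θ : TorusSite 3 L → ℝ) :
    ∑ k ∈ Finset.Icc 1 m, ∑ x : TorusSite 3 L, ∑ y : TorusSite 3 L, Real.cos (θ x - θ y) *
        Real.cos (2 * Real.pi * k * ((x 0).val : ℝ) / L - 2 * Real.pi * k * ((y 0).val : ℝ) / L) ≤
      ((L : ℝ) ^ 3) ^ 2 := by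
  refine le_trans (Finset.sum_le_sum_of_subset_of_nonneg ?_ fun k _ _ => ?_) (gp_charSum_bound θ)
  · intro k hk
    rw [Finset.mem_Icc] at hk
    rw [Finset.mem_range]
    omega
  · have h := gp_twistCorr_nonneg θ (fun x => 2 * Real.pi * k * ((x 0).val : ℝ) / L)
    exact h

/-- STUB `stub_characterSumBound` (registered on stmt-HubbardSuperconductivity-10739, line `schwarz-inheritance`, lead c19): the
**character-sum bound** — summed over the axial twists `g_k = 2πk x₀/L`, `k = 1,…,m < L`, the twisted two-point sums
`Σ_{x,y} cos(θ_x − θ_y) cos(g_k x − g_k y)` total at most `L⁶` (= `gp_twistCorr_sum_le`). [folklore] -/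
theorem stub_characterSumBound : ∀ (L : ℕ) [NeZero L] (m : ℕ), m < L → ∀ θ : TorusSite 3 L → ℝ, ∑ k ∈ Finset.Icc 1 m, ∑ x : TorusSite 3 L, ∑ y : TorusSite 3 L, Real.cos (θ x - θ y) * Real.cos (2 * Real.pi * k * ((x 0).val : ℝ) / L - 2 * Real.pi * k * ((y 0).val : ℝ) / L) ≤ ((L : ℝ) ^ 3) ^ 2 :=
  fun _L _ _m hmL θ => gp_twistCorr_sum_le hmL θ

end Summit.HubbardSuperconductivity.HubbardSuperconductivity.Theorems.PerturbedXYOrder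

end
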